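import Summits.Ventures.CertifiedManyBodySolver.Theses.R2cOpenStripTangentLine
import Literature.MathematicalPhysics.QuantumLattice.HubbardJordanWigner
import Literature.MathematicalPhysics.QuantumLattice.HubbardWave0LiebProofs

/-!
# Candidate proof (planner's SKETCH, attached as item evidence — a PROVER files it under `Theorems/`) of the route SUPPORT item
`BoxSpinConsumer` (stmt-Ventures-19552) of route `R2cOpenStripTangentLine`.

HONEST FRAMING: first certified bounds; not a superconductivity verdict; every number certified or labelled float.

The 2-D box analogue of `Upper.FMPSConsumer.hubbardChainEnergyDensityAt_le_of_spin_cert`: Jordan–Wigner transport of the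
spin-side certificate sentence to the Fock side, the homogeneous variational principle `LiebThm1.groundEnergy_mul_norm_le`,
and open-in-open stacking `groundEnergy_hubbardOpenBoxTT'_le_mul_openBox` with `Kx = 1`, `Ky = k`. [folklore]
-/

noncomputable section

open Matrix Finset
open scoped ComplexOrder BigOperators

namespace Summit.Ventures.CertifiedManyBodySolver.Theorems

open Literature.MathematicalPhysics.QuantumLattice
open Summit.Ventures.CertifiedManyBodySolver.Theses.R2cOpenStripTangentLine

/-- The route support item `BoxSpinConsumer` (stmt-Ventures-19552): a spin-side certificate sentence for ONE open `a × b` box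
at `(t, t′, U) = (1, 0, 8)` yields the undressed all-`k` family `E_open(a × k·b; k·N) ≤ k·E`. [folklore] -/
theorem boxSpinConsumer_proof : BoxSpinConsumer := by
  intro a b N φ E ha hb hNab hN hne hE k hk
  -- the Fock-side vector behind the spin-side certificate
  set ψ : Fock (Orb (Fin a ×ₗ Fin b)) := JordanWigner.toSpinVec.symm φ with hψ
  have hφ : JordanWigner.toSpinVec ψ = φ := by simp [hψ]
  have hψN : IsNParticle N ψ := by
    rw [JordanWigner.isNParticle_iff, hφ]
    exact hN
  have hψne : ψ ≠ 0 := by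
    intro h0
    apply hne
    rw [← hφ, h0, map_zero]
  -- move the sentence to the Fock side
  have hEψ : (expect (hubbardOpenBoxTT' a b 1 0 8) ψ).re ≤ (E : ℝ) * (star ψ ⬝ᵥ ψ).re := by
    have h1 : star ψ ⬝ᵥ ψ = star φ ⬝ᵥ φ := by
      rw [← JordanWigner.star_toSpinVec_dotProduct, hφ]
    rw [JordanWigner.expect_eq, hφ, h1]
    exact hE
  -- the norm is positive
  have hnorm_pos : 0 < (star ψ ⬝ᵥ ψ).re := by
    have h1 : 0 < star ψ ⬝ᵥ ψ :=
      lt_of_le_of_ne (dotProduct_star_self_nonneg ψ) (Ne.symm (mt dotProduct_star_self_eq_zero.1 hψne))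
    exact (Complex.pos_iff.1 h1).1
  -- homogeneous variational principle on the `N`-particle sector of ONE box
  have hvar := LiebThm1.groundEnergy_mul_norm_le (hubbardOpenBoxTT' a b 1 0 8) hψN
  have hG : groundEnergy (hubbardOpenBoxTT' a b 1 0 8) N ≤ (E : ℝ) :=
    le_of_mul_le_mul_right (hvar.trans hEψ) hnorm_pos
  -- open-in-open stacking of `k` copies along the second axis (`Kx = 1`, `Ky = k`)
  have hN2 : N ≤ 2 * (a * b) := by omega
  have hst := groundEnergy_hubbardOpenBoxTT'_le_mul_openBox a b 1 k (1 : ℝ) 0 8 hN2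
  rw [Nat.one_mul] at hst
  have hst' : groundEnergy (hubbardOpenBoxTT' a (k * b) 1 0 8) (k * N) ≤
      (k : ℝ) * groundEnergy (hubbardOpenBoxTT' a b 1 0 8) N := by
    simpa [Nat.one_mul, one_mul] using hst
  have hk0 : (0 : ℝ) ≤ (k : ℝ) := by positivity
  calc groundEnergy (hubbardOpenBoxTT' a (k * b) 1 0 8) (k * N)
      ≤ (k : ℝ) * groundEnergy (hubbardOpenBoxTT' a b 1 0 8) N := hst'
    _ ≤ (k : ℝ) * (E : ℝ) := mul_le_mul_of_nonneg_left hG hk0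
    _ = ((((k : ℚ) * E : ℚ)) : ℝ) := by push_cast; ring

end Summit.Ventures.CertifiedManyBodySolver.Theorems

end
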